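import Mathlib
import Literature.NumberTheory.GaloisRepresentations.GaloisRep
import Literature.NumberTheory.GaloisRepresentations.FramedRepEquivConj
import Literature.NumberTheory.GaloisRepresentations.RestrictFieldSemisimple
import Literature.NumberTheory.Automorphic.ReciprocityGLn
import Literature.NumberTheory.Automorphic.ReciprocityGLnProofs
import Literature.NumberTheory.Automorphic.ReciprocityGLnGaloisConjProofs
import Literature.NumberTheory.Automorphic.BaseChangeUnramifiedLift
import Literature.NumberTheory.Automorphic.BaseChangeArchimedeanDescent
import Literature.NumberTheory.Automorphic.TunnellOctahedralGlobal
import Literature.NumberTheory.Automorphic.TunnellOctahedralLocal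
import Summits.Langlands.Langlands.Theorems.PicardMuOrdinaryMuOrdinaryFamilyRTDictionary
import Summits.Langlands.Langlands.Theorems.PicardMuOrdinaryMuOrdinaryFamilyRTQuadraticDescentClifford
import HarnessLib
import Literature.NumberTheory.Automorphic.BaseChangeStrongUnramified

/-!
# Crux `MuOrdinaryFamilyRT` (stmt-Langlands-13757), line `char-zero-dominance`: stub 5,
# quadratic (cyclic) descent `F' → K` — conditional reduction to Arthur–Clozel's strong
# lifting and lang.S27

This file reduces STUB 5 (`stub_quadraticDescent`, reshaped by the second lead after wave 1) of
the checked skeleton `Cruxes/MuOrdinaryFamilyRT/Lines/char-zero-dominance.lean` for the crux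
`Summit.Langlands.Langlands.Theses.PicardMuOrdinary.MuOrdinaryFamilyRT` to NAMED published facts.
`S.stub_quadraticDescent` below is VERBATIM the registered statement (same namespace as the
skeleton; `K = CyclotomicField 3 ℚ` is the abbrev of `…Dictionary.lean`).  The registered
sub-goal proved here is `stub_quadraticDescent_of`:

    Literature.NumberTheory.Automorphic.ArthurClozel1989_strongLifting_unramified → cuspidal_descent_cyclic →
      exists_twist_quadraticSign → ArthurClozel1989_strongLifting_archimedean →
      (∀ N M hM Q, Q.exists_hasInfinityType) → exists_galoisRep_of_regularAlgebraic →
      S.stub_quadraticDescent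

Hypotheses, all named facts of the tree taken BY NAME except the first, which is the published
theorem still absent from the tree and is declared inline with its citation (the gate relocates
it to `Literature/NumberTheory/Automorphic/BaseChangeStrongUnramified.lean`):

* `ArthurClozel1989_strongLifting_unramified` (inline; Arthur–Clozel, Ann. of Math. Stud. 120,
  Ch. 3 Thm. 5.1 "weak lifting ⇒ strong lifting" read at the finite places unramified in `E/F`,
  with the unramified local base change of Ch. 1 §6) — for `E/F` Galois of prime degree and
  CUSPIDAL `π`, `Π` with `Π` a weak lift of `π`: the relation (1.1) `t_{Π,w} = t_{π,v}^{f(w|v)}`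
  at EVERY `w ∣ v`, `v` unramified in `E` and `π_v` unramified (`IsUnramifiedBaseChangeLift`),
  and conversely `π_v` is unramified as soon as `Π` is unramified at every `w ∣ v`;
* `cuspidal_descent_cyclic` (Arthur–Clozel Ch. 3 Thm. 4.2 (d): existence of a cuspidal weak
  descent of a `σ`-stable cuspidal `Π`);
* `exists_twist_quadraticSign` (the twist `π ⊗ η_{E/F}`, a.e. Satake parameters `ε(v) t_{π,v}`);
* `ArthurClozel1989_strongLifting_archimedean` (archimedean clause of Thm. 5.1, through the
  proved `isRegularAlgebraic_descent`) and `AutomorphicRepData.exists_hasInfinityType`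
  (Clozel 1990 §3.3, for every automorphic representation);
* `exists_galoisRep_of_regularAlgebraic` (lang.S27: Harris–Lan–Taylor–Thorne + Varma; `K` is
  CM, `isCMField_K`).

**Proof.**  Fix `F'/K` quadratic, `ι`, `S'`; put
`S := {𝔭 ramified in F'} ∪ {𝔭 ∣ 3} ∪ {𝔭 below S'}` (finite, independent of `ρ`, `P'`).  Given
`ρ` with `ρ|_{Γ_{F'}}` absolutely irreducible and `P'` regular algebraic cuspidal on
`GL₃(𝔸_{F'})`, unramified with integral `q_w t_{P',w}` off `S'` and compatible with `ρ|_{Γ_{F'}}`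
off `S' ∪ {w ∣ 3}`:
(1) `P'` has `Gal(F'/K)`-stable Satake data (sibling file,
`isGaloisStableSatakeAE_of_isGaloisCompatibleAt`: the Frobenius polynomials of a RESTRICTED
representation at the places over `v` coincide), so it descends weakly to a cuspidal `P` on
`GL₃(𝔸_K)` (`cuspidal_descent_cyclic`), and also to `P'' = P ⊗ η_{F'/K}`
(`exists_twist_quadraticSign`, `ε(v)^{f(w|v)} = 1`).
(2) `P`, `P''` are regular algebraic (`isRegularAlgebraic_descent`), so lang.S27 attaches
semisimple `r = r(P)`, `r'' = r(P'')` compatible with `P`, `P''` at every unramified `𝔭 ∤ 3`;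
their restrictions to `Γ_{F'}` are compatible with `P'` almost everywhere
(`eventually_isGaloisCompatibleAt_restrictField`), as is `ρ|_{Γ_{F'}}`, so by Chebotarev and
Brauer–Nesbitt (`nonempty_equiv_of_eventually_isGaloisCompatibleAt`) `r|_{Γ_{F'}} ≅ ρ|_{Γ_{F'}} ≅ r''|_{Γ_{F'}}`.
(3) The index-two Clifford dichotomy (sibling file, `clifford_index_two`) gives
`ρ ∈ {r, r ⊗ χ}` and `ρ ∈ {r'', r'' ⊗ χ}` up to conjugation, `χ = χ_{F'/K}`; the case
`ρ ~ r ⊗ χ ~ r'' ⊗ χ` would make `r'' ~ r`, impossible for `P'' = P ⊗ η` with `n = 3` odd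
(`not_conj_of_twist_quadraticSign`: at an inert good prime `t = -t`).  Hence `ρ` is CONJUGATE to
`r(P₁)` for `P₁ ∈ {P, P''}`, a cuspidal regular algebraic weak descent of `P'`.
(4) By the inline strong-lifting fact for `(P₁, P')`: at `𝔭 ∉ S` (unramified in `F'`, every
`w ∣ 𝔭` outside `S' ∪ {w ∣ 3}`) `P₁` is unramified with Satake `β` and `t_{P',w} = β^{f}`, so
`q_w a' = (q_𝔭 b)^{f}` is integral for `b ∈ β` and `q_𝔭 b ∈ ℤ̄` (`IsIntegral.of_pow`), whence
`t₀ = q_𝔭 Σβ ∈ ℤ̄`; and at `𝔭 ∤ 3` compatibility of `r(P₁)` with `P₁` (lang.S27, every unramified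
place) transports to the conjugate `ρ` (`isGaloisCompatibleAt_conj_iff`).

References: J. Arthur, L. Clozel, Ann. of Math. Stud. 120 (1989), Ch. 3 §1, Thm. 4.2 (d),
Thm. 5.1, Ch. 1 §6; M. Harris, K.-W. Lan, R. Taylor, J. Thorne, Res. Math. Sci. 3 (2016), Thm. A;
L. Clozel, *Motifs et formes automorphes* (1990), §3.3, Thm. 3.13 (algebraicity descends);
A. H. Clifford, Ann. of Math. 38 (1937), Thm. 1.
-/

-- `Summit.Langlands.Langlands.…` (summit = sub-problem name, D-0017 layout) trips `dupNamespace` on every decl.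
set_option linter.dupNamespace false

namespace Summit.Langlands.Langlands.Cruxes.MuOrdinaryFamilyRT.CharZeroDominance

open scoped NumberField Polynomial Matrix Classical MatrixGroups
open Field IsDedekindDomain Polynomial Filter NumberField
open Literature.NumberTheory.GaloisRepresentations Literature.NumberTheory.Automorphic

noncomputable section

/-! ## The registered statement (verbatim) -/

/-- STUB 5 — **quadratic (cyclic) descent `F' → K` with level, compatibility and integrality**
(Arthur–Clozel, Ann. of Math. Stud. 120, Ch. 3, Thm. 4.2 (d) with Thm. 5.1; known; size L), as
RESHAPED by the second lead after wave 1 (per-eigenvalue integrality of `N w · α` over `F'` is a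
hypothesis; the first typing was false by a `|det|^m` twist).  VERBATIM the registered statement
of the skeleton `Cruxes/MuOrdinaryFamilyRT/Lines/char-zero-dominance.lean`: `F'/K` quadratic,
`ρ : Γ_K → GL₃(ℚ̄₃)` with `ρ|Γ_{F'}` absolutely irreducible, `P'` regular algebraic cuspidal on
`GL₃(𝔸_{F'})`, unramified with integral `N w · α` outside `S'` and compatible with `ρ|Γ_{F'}` off
`S'` and `3`; then there is a regular algebraic cuspidal `P` on `GL₃(𝔸_K)`, unramified outside a
finite `S` depending only on `(F'/K, S')`, with `N𝔭·Σ Satake ∈ ℤ̄` at every `𝔭 ∉ S` and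
compatible with `ρ` at every `𝔭 ∉ S`, `𝔭 ∤ 3`.  Proved below CONDITIONALLY
(`stub_quadraticDescent_of`). -/
def S.stub_quadraticDescent : Prop :=
  ∀ (F' : Type) [Field F'] [NumberField F'] [Algebra K F'],
    Module.finrank K F' = 2 →
  ∀ (hcpt : isCompact_glFiniteIntegralLevel 3 (CyclotomicField 3 ℚ))
    (hcpt' : isCompact_glFiniteIntegralLevel 3 F') (ι : PadicAlgCl 3 ≃+* ℂ)
    (S' : Finset (HeightOneSpectrum (𝓞 F'))),
  ∃ S : Finset (HeightOneSpectrum (𝓞 K)),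
    ∀ (ρ : FramedGaloisRep K (PadicAlgCl 3) 3) (P' : CuspidalAutomorphicRepData 3 F' hcpt'),
      FramedRep.IsAbsolutelyIrreducible (ρ.restrictField F') →
      P'.1.IsRegularAlgebraic →
      (∀ w ∉ S', (∃ α : Multiset ℂ, P'.1.HasSatakeParamAt w α ∧
          ∀ a ∈ α, IsIntegral ℤ ((w.residueCard : ℂ) * a)) ∧
        (((3 : ℕ) : 𝓞 F') ∉ w.asIdeal → IsGaloisCompatibleAt P'.1 ι (ρ.restrictField F') w)) →
      ∃ P : CuspidalAutomorphicRepData 3 (CyclotomicField 3 ℚ) hcpt,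
        P.1.IsRegularAlgebraic ∧
        ∀ 𝔭 ∉ S, (∃ (α : Multiset ℂ) (t₀ : integralClosure ℤ ℂ),
            P.1.HasSatakeParamAt 𝔭 α ∧ (t₀ : ℂ) = (𝔭.residueCard : ℂ) * α.sum) ∧
          (((3 : ℕ) : 𝓞 K) ∉ 𝔭.asIdeal → IsGaloisCompatibleAt P.1 ι ρ 𝔭)

/-! ## The published fact still absent from the tree (inline; relocated by the gate) -/

/-- `K = ℚ(ζ₃)` is a CM field in Mathlib's sense (`IsCyclotomicExtension.Rat.isCMField`; the
`ℚ`-algebra diamond on `CyclotomicField 3 ℚ` is crossed by `Subsingleton (Algebra ℚ _)`).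
[folklore] -/
theorem isCMField_K : IsCMField K := by
  -- adapted from `isCMField_cyclotomicField_three` (Cruxes/RegularAdjointLiftCM/Disproof.lean)
  have h1 : @IsCyclotomicExtension {3} ℚ (CyclotomicField 3 ℚ) _ _ (CyclotomicField.algebra 3 ℚ) :=
    CyclotomicField.isCyclotomicExtension 3 ℚ
  have e : (CyclotomicField.algebra 3 ℚ : Algebra ℚ (CyclotomicField 3 ℚ)) =
      DivisionRing.toRatAlgebra := Subsingleton.elim _ _
  have h2 : @IsCyclotomicExtension {3} ℚ (CyclotomicField 3 ℚ) _ _ DivisionRing.toRatAlgebra := by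
    rw [← e]; exact h1
  exact @IsCyclotomicExtension.Rat.isCMField (CyclotomicField 3 ℚ) _ _ {3} ⟨3, rfl, by norm_num⟩ h2

/-- Only finitely many finite places of a number field contain a given non-zero natural number
(the prime factors of the ideal it generates). [folklore] -/
theorem finite_setOf_natCast_mem {M : Type*} [Field M] [NumberField M] {p : ℕ} (hp : p ≠ 0) :
    {v : HeightOneSpectrum (𝓞 M) | ((p : ℕ) : 𝓞 M) ∈ v.asIdeal}.Finite := by
  -- adapted from `finite_setOf_natCast_mem_asIdeal` (Automorphic/CompletedCohomologyHeckeAlgebraGLn)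
  have hp' : (Ideal.span {((p : ℕ) : 𝓞 M)} : Ideal (𝓞 M)) ≠ 0 := by
    rw [Ne, Ideal.zero_eq_bot, Ideal.span_singleton_eq_bot]
    exact_mod_cast hp
  refine (Ideal.finite_factors hp').subset fun v hv => ?_
  exact (Ideal.dvd_span_singleton).2 hv

/-- **Twists by `η_{E/F}` have the same weak base-change lift to `E`** (rank `n`; the rank-`2`
case is `IsWeakBaseChangeLiftAE.of_twist_quadraticSign` of `TunnellOctahedralGlobal`): if `Π` is a
weak lift of `π` along the quadratic `E/F` and `π'` has Satake parameters `ε_{E/F}(v) t_{π,v}`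
almost everywhere, then `Π` is a weak lift of `π'` too, since `ε_{E/F}(v)^{f(w|v)} = 1`
(`quadraticSign_pow_inertiaDeg`; the trivial direction of Arthur–Clozel Ch. 3, Thm. 3.1).
[folklore] -/
theorem isWeakBaseChangeLiftAE_of_twist_quadraticSign {F E : Type} [Field F] [NumberField F]
    [Field E] [NumberField E] [Algebra F E] (h2 : Module.finrank F E = 2) {n : ℕ}
    {hF : isCompact_glFiniteIntegralLevel n F} {hE : isCompact_glFiniteIntegralLevel n E}
    {π π' : AutomorphicRepData (AutomorphyDatum.gl n F hF)}
    {P : AutomorphicRepData (AutomorphyDatum.gl n E hE)} (hlift : IsWeakBaseChangeLiftAE π P)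
    (htw : ∀ᶠ v : HeightOneSpectrum (𝓞 F) in cofinite, ∀ α : Multiset ℂ,
      π.HasSatakeParamAt v α → π'.HasSatakeParamAt v (α.map (quadraticSign E v * ·))) :
    IsWeakBaseChangeLiftAE π' P := by
  -- adapted from `IsWeakBaseChangeLiftAE.of_twist_quadraticSign` (TunnellOctahedralGlobal, `n = 2`)
  have A := eventually_under (E := E) (π.hasSatakeParamAt_cofinite_holds.and htw)
  refine (hlift.and A).mono fun w ⟨hw0, hwA⟩ v α₁ hv hα₁ => ?_
  obtain ⟨⟨α₀, hα₀⟩, htwv⟩ := hwA v hv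
  have heq : α₁ = α₀.map (quadraticSign E v * ·) :=
    π'.hasSatakeParamAt_unique_holds hα₁ (htwv α₀ hα₀)
  have h0 := hw0 v α₀ hv hα₀
  rw [heq, Multiset.map_map]
  convert h0 using 2
  simp only [Function.comp_apply, mul_pow, quadraticSign_pow_inertiaDeg h2 v w hv, one_mul]

/-! ## The conditional reduction (registered sub-goal) -/

/-- **Stub 5 from Arthur–Clozel's strong lifting, cyclic descent, the quadratic twist, the
archimedean clause (with Clozel's infinity types) and lang.S27.**  See the module docstring for
the proof: descend `P'` weakly (`cuspidal_descent_cyclic`, σ-stability from compatibility with the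
restricted `ρ`), form `P'' = P ⊗ η`, attach `r(P)`, `r(P'')` by lang.S27 (`K` CM), identify `ρ`
with a conjugate of one of them by Chebotarev–Brauer–Nesbitt over `F'` and the index-two Clifford
dichotomy (`n = 3` odd rules out the doubly-twisted case), and read unramifiedness, (1.1),
integrality (`IsIntegral.of_pow` at inert primes) and compatibility at every `𝔭 ∉ S` off the
inline strong-lifting fact; `S = {ramified in F'} ∪ {∣ 3} ∪ {below S'}` is uniform in `(ρ, P')`.
[cite: ArthurClozelAMS120, Ch. 3 Thm. 4.2 (d) and Thm. 5.1] -/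
theorem stub_quadraticDescent_of : Literature.NumberTheory.Automorphic.ArthurClozel1989_strongLifting_unramified → cuspidal_descent_cyclic → exists_twist_quadraticSign → ArthurClozel1989_strongLifting_archimedean → (∀ (N : ℕ) (M : Type) [Field M] [NumberField M] (hM : isCompact_glFiniteIntegralLevel N M) (Q : AutomorphicRepData (AutomorphyDatum.gl N M hM)), Q.exists_hasInfinityType) → exists_galoisRep_of_regularAlgebraic → S.stub_quadraticDescent := by
  intro hAC hdesc htw hArch hInf hS27 F' _ _ _ hdeg hcpt hcpt' ι S'
  -- Galois theory of the quadratic extension `F'/K`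
  haveI : FiniteDimensional K F' := Module.finite_of_finrank_eq_succ hdeg
  haveI : Algebra.IsQuadraticExtension K F' := ⟨hdeg⟩
  haveI : IsGalois K F' := inferInstance
  have hprime : (Module.finrank K F').Prime := by rw [hdeg]; exact Nat.prime_two
  have hcyc : IsCyclic (F' ≃ₐ[K] F') :=
    isCyclic_of_prime_card (p := Module.finrank K F') (hp := ⟨hprime⟩)
      (IsGalois.card_aut_eq_finrank K F')
  have hKCM : IsTotallyReal K ∨ IsCMField K := Or.inr isCMField_K
  -- the level `S` over `K`: ramified in `F'`, above `3`, below `S'`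
  have hfin₁ : {v : HeightOneSpectrum (𝓞 K) | ¬ Algebra.IsUnramifiedIn (𝓞 F') v.asIdeal}.Finite :=
    finite_setOf_not_isUnramifiedIn K F'
  have hfin₂ : {v : HeightOneSpectrum (𝓞 K) | ((3 : ℕ) : 𝓞 K) ∈ v.asIdeal}.Finite :=
    finite_setOf_natCast_mem (by norm_num)
  have hfin₃ : {w : HeightOneSpectrum (𝓞 F') | ((3 : ℕ) : 𝓞 F') ∈ w.asIdeal}.Finite :=
    finite_setOf_natCast_mem (by norm_num)
  have hS : ∀ 𝔭 ∉ hfin₁.toFinset ∪ hfin₂.toFinset ∪ S'.image (fun w => w.under (𝓞 K)),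
      Algebra.IsUnramifiedIn (𝓞 F') 𝔭.asIdeal ∧ ((3 : ℕ) : 𝓞 K) ∉ 𝔭.asIdeal ∧
      ∀ w : HeightOneSpectrum (𝓞 F'), w.asIdeal.under (𝓞 K) = 𝔭.asIdeal →
        w ∉ S' ∧ ((3 : ℕ) : 𝓞 F') ∉ w.asIdeal := by
    intro 𝔭 h𝔭
    simp only [Finset.mem_union, Set.Finite.mem_toFinset, Set.mem_setOf_eq, Finset.mem_image,
      not_or, not_not, not_exists, not_and] at h𝔭
    obtain ⟨⟨h1, h2⟩, h3⟩ := h𝔭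
    refine ⟨h1, h2, fun w hw => ⟨fun hwS => h3 w hwS (HeightOneSpectrum.ext hw), fun h3w => h2 ?_⟩⟩
    rw [← hw]
    change ((3 : ℕ) : 𝓞 K) ∈ Ideal.comap (algebraMap (𝓞 K) (𝓞 F')) w.asIdeal
    rw [Ideal.mem_comap, map_natCast]
    exact h3w
  refine ⟨hfin₁.toFinset ∪ hfin₂.toFinset ∪ S'.image (fun w => w.under (𝓞 K)),
    fun ρ P' hirr hreg hS' => ?_⟩
  -- data of `P'` at the good places of `F'`
  have hgoodw : ∀ w : HeightOneSpectrum (𝓞 F'), w ∉ S' → ((3 : ℕ) : 𝓞 F') ∉ w.asIdeal →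
      P'.1.IsUnramifiedAt w ∧ IsGaloisCompatibleAt P'.1 ι (ρ.restrictField F') w := by
    intro w hw h3
    obtain ⟨⟨α, hα, -⟩, hc⟩ := hS' w hw
    exact ⟨⟨α, hα⟩, hc h3⟩
  have hae : ∀ᶠ w : HeightOneSpectrum (𝓞 F') in cofinite,
      P'.1.IsUnramifiedAt w ∧ IsGaloisCompatibleAt P'.1 ι (ρ.restrictField F') w := by
    have h1 : ∀ᶠ w : HeightOneSpectrum (𝓞 F') in cofinite, w ∉ S' := by
      rw [eventually_cofinite]
      simpa only [not_not, Finset.setOf_mem] using S'.finite_toSet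
    have h2 : ∀ᶠ w : HeightOneSpectrum (𝓞 F') in cofinite, ((3 : ℕ) : 𝓞 F') ∉ w.asIdeal := by
      rw [eventually_cofinite]
      simpa only [not_not] using hfin₃
    filter_upwards [h1, h2] with w hw h3 using hgoodw w hw h3
  -- (1) σ-stability, weak descent `P`, twisted descent `P''`
  have hstab : IsGaloisStableSatakeAE K P'.1 :=
    isGaloisStableSatakeAE_of_isGaloisCompatibleAt P'.1 ι ρ hae
  obtain ⟨P, hBC⟩ := hdesc 3 K F' hcpt hcpt' hcyc hprime P' hstab
  obtain ⟨P'', htwP⟩ := htw 3 K F' hdeg hcpt P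
  have hBC'' : IsWeakBaseChangeLiftAE P''.1 P'.1 :=
    isWeakBaseChangeLiftAE_of_twist_quadraticSign hdeg hBC htwP
  -- (2) Galois representations of the weak descents (lang.S27), conjugate to `ρ` on `Γ_{F'}`
  have hirr' : (ρ.restrictField F').IsIrreducible := hirr.isIrreducible
  have hρss : (ρ.restrictField F').toGaloisRep.IsSemisimple := by
    haveI : IsSimpleOrder (Subrepresentation (ρ.restrictField F').toRepresentation) := hirr'
    change ComplementedLattice (Subrepresentation (ρ.restrictField F').toRepresentation)
    infer_instance
  have hfin₂' : ∀ᶠ v : HeightOneSpectrum (𝓞 K) in cofinite, ((3 : ℕ) : 𝓞 K) ∉ v.asIdeal := by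
    rw [eventually_cofinite]
    simpa only [not_not] using hfin₂
  have hS27' : ∀ P₁ : CuspidalAutomorphicRepData 3 K hcpt, IsWeakBaseChangeLiftAE P₁.1 P'.1 →
      P₁.1.IsRegularAlgebraic ∧ ∃ r : FramedGaloisRep K (PadicAlgCl 3) 3,
        (∀ (v : HeightOneSpectrum (𝓞 K)) (α : Multiset ℂ), P₁.1.HasSatakeParamAt v α →
          ((3 : ℕ) : 𝓞 K) ∉ v.asIdeal →
            r.IsUnramifiedAt v ∧ r.HasFrobCharpolyAt v (arithFrobPolyOfSatake ι v.residueCard 3 α)) ∧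
        (∀ᶠ v : HeightOneSpectrum (𝓞 K) in cofinite, IsGaloisCompatibleAt P₁.1 ι r v) ∧
        ∃ Q : GL (Fin 3) (PadicAlgCl 3), r.restrictField F' = (ρ.restrictField F').conj Q := by
    intro P₁ hBC₁
    have hreg₁ : P₁.1.IsRegularAlgebraic :=
      hArch.isRegularAlgebraic_descent hcyc hprime hBC₁ (hInf 3 K hcpt P₁.1) hreg
    obtain ⟨r, hrss, hrc⟩ := hS27 hcpt hKCM P₁ hreg₁ 3 ι
    have hcK : ∀ᶠ v : HeightOneSpectrum (𝓞 K) in cofinite, IsGaloisCompatibleAt P₁.1 ι r v :=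
      hfin₂'.mono fun v hv α hα => hrc v α hα hv
    have hcF' := eventually_isGaloisCompatibleAt_restrictField P₁.1 P'.1 hBC₁ ι r hcK
    obtain ⟨e⟩ := nonempty_equiv_of_eventually_isGaloisCompatibleAt P'.1 ι (ρ.restrictField F')
      (r.restrictField F') hρss (r.isSemisimple_restrictField hrss) (hae.mono fun w hw => hw.2) hcF'
    obtain ⟨Q, hQ⟩ := FramedRep.exists_eq_conj_of_equiv _ _ e
    exact ⟨hreg₁, r, hrc, hcK, Q, hQ⟩
  -- (3) Clifford: `ρ` is conjugate to `r(P₁)` for `P₁ = P` or `P₁ = P''`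
  obtain ⟨P₁, hBC₁, hreg₁, r₁, Q₁, hrc₁, hρ⟩ : ∃ P₁ : CuspidalAutomorphicRepData 3 K hcpt,
      IsWeakBaseChangeLiftAE P₁.1 P'.1 ∧ P₁.1.IsRegularAlgebraic ∧
      ∃ (r₁ : FramedGaloisRep K (PadicAlgCl 3) 3) (Q₁ : GL (Fin 3) (PadicAlgCl 3)),
        (∀ (v : HeightOneSpectrum (𝓞 K)) (α : Multiset ℂ), P₁.1.HasSatakeParamAt v α →
          ((3 : ℕ) : 𝓞 K) ∉ v.asIdeal →
            r₁.IsUnramifiedAt v ∧ r₁.HasFrobCharpolyAt v (arithFrobPolyOfSatake ι v.residueCard 3 α)) ∧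
        ρ = r₁.conj Q₁ := by
    obtain ⟨χ, hχ₁, hχ₂⟩ := exists_quadChar (A := PadicAlgCl 3) (L := K) (E := F') hdeg
    obtain ⟨hregP, r, hrc, hcK, Q, hQ⟩ := hS27' P hBC
    rcases clifford_index_two hdeg ρ r hirr' Q hQ χ hχ₁ hχ₂ with h | h
    · exact ⟨P, hBC, hregP, r, Q⁻¹, hrc, h⟩
    obtain ⟨hregP'', r'', hr''c, hc''K, Q'', hQ''⟩ := hS27' P'' hBC''
    rcases clifford_index_two hdeg ρ r'' hirr' Q'' hQ'' χ hχ₁ hχ₂ with h'' | h''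
    · exact ⟨P'', hBC'', hregP'', r'', Q''⁻¹, hr''c, h''⟩
    -- both twisted: `r''` would be conjugate to `r`
    exfalso
    have hconj := eq_conj_of_twist_conj_eq χ (mul_self_eq_one_of_quadChar χ hχ₁ hχ₂) r r'' Q⁻¹ Q''⁻¹
      (h''.symm.trans h)
    exact not_conj_of_twist_quadraticSign (by decide) hdeg P.1 P''.1 ι r r'' _ htwP hcK hc''K hconj
  -- (4) conclude with `P₁`: strong lifting at the unramified places
  obtain ⟨hU, hD⟩ := hAC 3 K F' hprime hcpt hcpt' P₁ P' hBC₁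
  refine ⟨P₁, hreg₁, fun 𝔭 h𝔭 => ?_⟩
  obtain ⟨h𝔭unr, -, h𝔭w⟩ := hS 𝔭 h𝔭
  have hP'unr : ∀ w : HeightOneSpectrum (𝓞 F'), w.asIdeal.under (𝓞 K) = 𝔭.asIdeal →
      P'.1.IsUnramifiedAt w :=
    fun w hw => (hgoodw w (h𝔭w w hw).1 (h𝔭w w hw).2).1
  obtain ⟨β, hβ⟩ := hD 𝔭 h𝔭unr hP'unr
  refine ⟨⟨β, ⟨(𝔭.residueCard : ℂ) * β.sum, ?_⟩, hβ, rfl⟩, fun h3 => ?_⟩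
  · -- integrality of `q_𝔭 · Σ β` from per-eigenvalue integrality over `F'`
    have hsum : (𝔭.residueCard : ℂ) * β.sum = (β.map fun a => (𝔭.residueCard : ℂ) * a).sum := by
      rw [Multiset.sum_map_mul_left, Multiset.map_id']
    rw [mem_integralClosure_iff, hsum]
    refine IsIntegral.multiset_sum fun x hx => ?_
    obtain ⟨a, ha, rfl⟩ := Multiset.mem_map.mp hx
    obtain ⟨w, hw⟩ := exists_above (E := F') 𝔭
    have hβw := hU w 𝔭 β hw h𝔭unr hβ
    obtain ⟨⟨α, hα, hint⟩, -⟩ := hS' w (h𝔭w w hw).1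
    obtain rfl := P'.1.hasSatakeParamAt_unique_holds hα hβw
    have hf : 0 < w.asIdeal.inertiaDeg (𝓞 K) := by
      rcases inertiaDeg_eq_one_or_two_of_finrank_eq_two hdeg 𝔭 w hw with h | h <;> omega
    refine IsIntegral.of_pow hf ?_
    have hi := hint (a ^ w.asIdeal.inertiaDeg (𝓞 K)) (Multiset.mem_map_of_mem _ ha)
    rwa [residueCard_eq_residueCard_pow_inertiaDeg hw, Nat.cast_pow, ← mul_pow] at hi
  · -- compatibility with `ρ = Q₁ r(P₁) Q₁⁻¹` at `𝔭 ∤ 3`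
    rw [hρ, isGaloisCompatibleAt_conj_iff]
    exact fun α hα => hrc₁ 𝔭 α hα h3

end

end Summit.Langlands.Langlands.Cruxes.MuOrdinaryFamilyRT.CharZeroDominance
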